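import Summits.ValiantsHypothesis.ValiantsHypothesis.Theorems.KPlusLogSqLawTropicalBSplit
import Summits.ValiantsHypothesis.ValiantsHypothesis.Theorems.KPlusLogSqLawTropicalBSmallFormats
import Summits.ValiantsHypothesis.ValiantsHypothesis.Theorems.KPlusLogSqLawTropicalBRelabel

/-!
# Route `KPlusLogSqLaw`, crux `TropicalB` — the BANDED sector (lower bandwidth `w`): a sector that widens with `K`

HONEST FRAMING.  Helper toward the registered stubs `stub_tropThin` / `stub_tropFat` of
`Cruxes/TropicalB/Lines/birth.lean` (crux `Summit.ValiantsHypothesis.ValiantsHypothesis.Theses.KPlusLogSqLaw.TropicalB`,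
ledger item `stmt-ValiantsHypothesis-19771`, route `KPlusLogSqLaw`; cell `pub-symmetroid`, seat `val-sym-trop-p3`,
2026-08-26).  A SECTOR theorem of an OPEN conjecture: nothing here bounds `TropicalB` for general supports, and nothing
bears on `KPlusLogSqLaw`, `MatrixDescartes` or `VP ≠ VNP`.

THE SECTOR.  A design `ε` has LOWER BANDWIDTH `w` if an entry in row `a`, column `b` can be present only when `a ≤ b + w`
(hypothesis stated inline, `∀ a b l, ε a b l ≠ 0 → a ≤ b + w`; `w = 1` is the Hessenberg = DAG-path class of
`…TropicalBSplitDefs.IsHessenberg`, whose `K + log² m` law is val-sym-trop-p5's / val-sym-trop-p1's theorem — cited, not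
restated here).  Running val-sym-trop-p1's landed core state lemma `designRowD_split` (p420147) with the state family
«`c`-subsets of the rows `[0, c + w)`» — at most `C(c+w, c) = multichoose (w+1) c ≤ (c+1)^w` states (stars and bars,
`TropicalCensus.multichoose_le_succ_pow`) — and checking that both restrictions are again of lower bandwidth `w`
(`band_restrict_left/right`: an increasing enumeration of the rows outside such a state satisfies `c + i ≤ r i` for
`i ≥ w`), the dyadic recursion gives

* `designRowD_band_pow` / `designRowD_band` : unsigned row bound `(K+1)·2^((w+1)·(L+1)·(L+2)) − 1`, `L = log₂ m`;
* `band_kPlusLogSq_fixedWidth` : for every `w`, the crux's inequality with `C = 6w + 7` on all designs of lower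
  bandwidth `w` (Gusfield's quasi-polynomial bound, `w`-banded form);
* `band_kPlusLogSq` : **one absolute constant `C = 7` for every design whose lower bandwidth satisfies
  `w · log₂² m ≤ K`** — a sector that WIDENS WITH `K`: in the fat regime `log₂² m ≤ K` it admits bandwidth `K / log₂² m`
  (e.g. `m / log₂³ m` at `K = m / log₂ m`), which is the shape «O(1) bits per class» of `stub_tropFat` predicts;
* `band_kPlusLogSq_of_relabel` : the same after any relabeling of rows and columns (val-sym-trop-p1's
  `…TropicalBRelabel.designRowD_of_relabel`), e.g. supports inside two permutation matrices are Hessenberg up to relabeling;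
  `band_kPlusLogSq_upper` : upper-banded designs (`b ≤ a + w`) by the order-reversing relabeling.

Template and credit: the recursion skeleton follows val-sym-trop-p1's Hessenberg file (HOME/val-sym-trop-p1/
TropicalBHessenberg.lean, unfiled per R1328; Hessenberg headline theorem: val-sym-trop-p5).  [folklore: Gusfield 1980 /
Carstensen 1983 divide and conquer for parametric shortest paths, in the dominance vocabulary]
-/

set_option linter.dupNamespace false
set_option autoImplicit false

namespace Summit.ValiantsHypothesis.ValiantsHypothesis.Theorems.KPlusLogSqLaw

open Summit.ValiantsHypothesis.ValiantsHypothesis.Theorems.MatrixDescartes.Negative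
open Summit.ValiantsHypothesis.ValiantsHypothesis.Theorems.LacunarySymmetroidMatrixDescartes
open Summit.ValiantsHypothesis.ValiantsHypothesis.Theorems.LacunarySymmetroidMatrixDescartes.TropicalCensus
open scoped BigOperators
open Finset

/-! ## 1. Increasing enumerations -/

/-- a strictly increasing map `Fin a → Fin b` gains at least the index difference: `r j + (i − j) ≤ r i` for `j ≤ i`.
[folklore] -/
theorem band_add_le_of_strictMono {a b : ℕ} (r : Fin a → Fin b) (hr : StrictMono r) :
    ∀ (n : ℕ) (j i : Fin a), (i : ℕ) = j + n → (r j : ℕ) + n ≤ (r i : ℕ) := by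
  intro n
  induction n with
  | zero =>
    intro j i h
    have : i = j := Fin.ext (by omega)
    subst this; simp
  | succ n ih =>
    intro j i h
    have hi' : (j : ℕ) + n < a := by have := i.isLt; omega
    set i' : Fin a := ⟨(j : ℕ) + n, hi'⟩ with hi'def
    have h1 := ih j i' rfl
    have hlt : r i' < r i := hr (Fin.mk_lt_of_lt_val (by rw [h]; exact Nat.lt_succ_self _))
    rw [Fin.lt_def] at hlt
    omega

/-- in particular `i ≤ r i`. [folklore] -/
theorem band_le_val_of_strictMono {a b : ℕ} (r : Fin a → Fin b) (hr : StrictMono r) (i : Fin a) :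
    (i : ℕ) ≤ (r i : ℕ) := by
  rcases Nat.eq_zero_or_pos a with ha | ha
  · exact absurd i.isLt (by omega)
  · have := band_add_le_of_strictMono r hr i ⟨0, ha⟩ i (by simp)
    omega

/-- the rows with value `< c + w` form a set of size at most `c + w`. [folklore] -/
theorem card_filter_val_lt_le (n c w : ℕ) :
    ((univ : Finset (Fin n)).filter (fun x : Fin n => x.val < c + w)).card ≤ c + w := by
  calc ((univ : Finset (Fin n)).filter (fun x : Fin n => x.val < c + w)).card ≤ (range (c + w)).card := by
        refine card_le_card_of_injOn (fun x : Fin n => x.val) (fun x hx => ?_) (fun x _ y _ h => Fin.ext h)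
        exact mem_coe.mpr (mem_range.mpr (mem_filter.mp (mem_coe.mp hx)).2)
    _ = c + w := card_range _

/-- **rows outside a band state are eventually large.**  If `R` is a `c`-subset of the rows `[0, c + w)` of
`Fin (c + e)` and `r : Fin e → Fin (c + e)` is a strictly increasing enumeration avoiding `R`, then `c + i ≤ r i` for
every `i ≥ w` (at most `w` rows outside `R` lie below `c + w`). [folklore] -/
theorem band_add_le_val_of_compl {c e w : ℕ} (R : Finset (Fin (c + e)))
    (hRS : R ⊆ (univ : Finset (Fin (c + e))).filter (fun x : Fin (c + e) => x.val < c + w)) (hRc : R.card = c)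
    (r : Fin e → Fin (c + e)) (hr : StrictMono r) (hrR : ∀ i, r i ∉ R) :
    ∀ i : Fin e, w ≤ (i : ℕ) → c + (i : ℕ) ≤ (r i : ℕ) := by
  classical
  set S := (univ : Finset (Fin (c + e))).filter (fun x : Fin (c + e) => x.val < c + w) with hS
  have hScard : S.card ≤ c + w := card_filter_val_lt_le (c + e) c w
  have hdiff : (S \ R).card ≤ w := by rw [card_sdiff_of_subset hRS]; omega
  intro i hi
  -- among `r 0, …, r w` some value is `≥ c + w`
  have hwe : w < e := lt_of_le_of_lt hi i.isLt
  have hex : ∃ j : Fin e, (j : ℕ) ≤ w ∧ c + w ≤ (r j : ℕ) := by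
    by_contra hcon
    push Not at hcon
    set J := (univ : Finset (Fin e)).filter (fun j : Fin e => (j : ℕ) ≤ w) with hJ
    have hJcard : J.card = w + 1 := by
      have hJ' : J = Iic (⟨w, hwe⟩ : Fin e) := by
        ext j
        simp only [hJ, mem_filter, mem_univ, true_and, mem_Iic, Fin.le_def]
      rw [hJ', Fin.card_Iic]
    have hmaps : ∀ j ∈ J, r j ∈ S \ R := by
      intro j hj
      rw [hJ, mem_filter] at hj
      exact mem_sdiff.mpr ⟨mem_filter.mpr ⟨mem_univ _, hcon j hj.2⟩, hrR j⟩
    have hinj : Set.InjOn r J := fun x _ y _ h => hr.injective h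
    have := card_le_card_of_injOn r hmaps hinj
    omega
  obtain ⟨j, hjw, hj⟩ := hex
  have hji : (j : ℕ) ≤ i := hjw.trans hi
  have hgain := band_add_le_of_strictMono r hr ((i : ℕ) - j) j i (by omega)
  omega

/-! ## 2. Banded designs under the column split -/

section BandSplit

variable {c e K : ℕ} (w : ℕ)

/-- the states of a banded design: the first-block row set of a present term is a `c`-subset of the rows `[0, c + w)`.
[folklore] -/
theorem band_state_mem (ε : Fin (c + e) → Fin (c + e) → Fin K → ℤ)
    (hε : ∀ a b l, ε a b l ≠ 0 → (a : ℕ) ≤ (b : ℕ) + w)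
    (q : Equiv.Perm (Fin (c + e)) × (Fin (c + e) → Fin K)) (hq : termSign ε q ≠ 0) :
    ((univ : Finset (Fin c)).image fun j => q.1 (Fin.castAdd e j)) ∈
      ((univ : Finset (Fin (c + e))).filter (fun x : Fin (c + e) => x.val < c + w)).powersetCard c := by
  classical
  rw [mem_powersetCard]
  refine ⟨fun x hx => ?_, ?_⟩
  · obtain ⟨j, _, rfl⟩ := mem_image.mp hx
    have hpres := (termSign_ne_zero_iff ε q).mp hq (Fin.castAdd e j)
    have h := hε _ _ _ hpres
    simp only [Fin.val_castAdd] at h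
    exact mem_filter.mpr ⟨mem_univ _, by have := j.isLt; omega⟩
  · have hinj : Function.Injective fun j : Fin c => q.1 (Fin.castAdd e j) :=
      q.1.injective.comp (Fin.castAdd_injective _ _)
    rw [card_image_of_injective _ hinj, card_univ, Fintype.card_fin]

/-- **at most `(c+1)^w` states** occur for a banded design: `C(c+w, c) = multichoose (w+1) c ≤ (c+1)^w` (stars and bars).
[folklore] -/
theorem card_bandStates_le :
    (((univ : Finset (Fin (c + e))).filter (fun x : Fin (c + e) => x.val < c + w)).powersetCard c).card
      ≤ (c + 1) ^ w := by
  classical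
  rw [card_powersetCard]
  calc ((univ : Finset (Fin (c + e))).filter (fun x : Fin (c + e) => x.val < c + w)).card.choose c
      ≤ (c + w).choose c := Nat.choose_le_choose c (card_filter_val_lt_le (c + e) c w)
    _ = Nat.multichoose (w + 1) c := by
        rw [Nat.multichoose_eq]
        congr 1; omega
    _ ≤ (c + 1) ^ (w + 1 - 1) := multichoose_le_succ_pow (w + 1) c
    _ = (c + 1) ^ w := by simp

/-- the first restricted design (rows increasing, first column block) of a banded design is banded. [folklore] -/
theorem band_restrict_left (ε : Fin (c + e) → Fin (c + e) → Fin K → ℤ)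
    (hε : ∀ a b l, ε a b l ≠ 0 → (a : ℕ) ≤ (b : ℕ) + w) (r : Fin c ↪o Fin (c + e)) :
    ∀ (i j : Fin c) (l : Fin K), ε (r i) (Fin.castAdd e j) l ≠ 0 → (i : ℕ) ≤ (j : ℕ) + w := by
  intro i j l h
  have h1 := hε _ _ _ h
  have h2 := band_le_val_of_strictMono r r.strictMono i
  simp only [Fin.val_castAdd] at h1
  omega

/-- the second restricted design of a banded design at a band state (rows outside a `c`-subset of `[0, c+w)`,
increasing; second column block) is banded. [folklore] -/
theorem band_restrict_right (ε : Fin (c + e) → Fin (c + e) → Fin K → ℤ)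
    (hε : ∀ a b l, ε a b l ≠ 0 → (a : ℕ) ≤ (b : ℕ) + w)
    (R : Finset (Fin (c + e))) (hRS : R ⊆ (univ : Finset (Fin (c + e))).filter (fun x : Fin (c + e) => x.val < c + w))
    (hRc : R.card = c) (r : Fin e ↪o Fin (c + e)) (hrR : ∀ i, r i ∉ R) :
    ∀ (i j : Fin e) (l : Fin K), ε (r i) (Fin.natAdd c j) l ≠ 0 → (i : ℕ) ≤ (j : ℕ) + w := by
  intro i j l h
  have h1 := hε _ _ _ h
  simp only [Fin.val_natAdd] at h1
  rcases Nat.lt_or_ge (i : ℕ) w with hi | hi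
  · omega
  · have h2 := band_add_le_val_of_compl R hRS hRc r r.strictMono hrR i hi
    omega

end BandSplit

/-! ## 3. The quasi-polynomial bound for banded designs -/

/-- **Gusfield's bound, banded dyadic form.**  Every design of lower bandwidth `w` and format `m ≤ 2^t` with `K`
classes has unsigned row bound `(K + 1)·2^((w+1)·(t·(t+1))) − 1`. [folklore: Gusfield 1980, banded form] -/
theorem designRowD_band_pow (K w t : ℕ) : ∀ m : ℕ, m ≤ 2 ^ t →
    ∀ (d : Fin K → ℕ) (v ε : Fin m → Fin m → Fin K → ℤ), (∀ a b l, ε a b l ≠ 0 → (a : ℕ) ≤ (b : ℕ) + w) →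
      DesignRowD d v ε ((K + 1) * 2 ^ ((w + 1) * (t * (t + 1))) - 1) := by
  induction t with
  | zero =>
    intro m hm d v ε _
    have hm1 : m ≤ 1 := by simpa using hm
    rcases Nat.le_one_iff_eq_zero_or_eq_one.mp hm1 with rfl | rfl
    · exact designRowD_mono (Nat.zero_le _) (tropRowD_size_zero K 0 d v ε)
    · refine designRowD_mono ?_ (tropRowD_one K d v ε)
      simp
  | succ t ih =>
    intro m hm d v ε hε
    set G := (K + 1) * 2 ^ ((w + 1) * (t * (t + 1))) with hG
    -- the bound is monotone in `t`
    have hmonoG : G - 1 ≤ (K + 1) * 2 ^ ((w + 1) * ((t + 1) * (t + 1 + 1))) - 1 := by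
      have : 2 ^ ((w + 1) * (t * (t + 1))) ≤ 2 ^ ((w + 1) * ((t + 1) * (t + 1 + 1))) :=
        Nat.pow_le_pow_right (by norm_num) (Nat.mul_le_mul_left _ (by nlinarith))
      have := Nat.mul_le_mul_left (K + 1) this
      simp only [hG]; omega
    by_cases hsmall : m ≤ 2 ^ t
    · exact designRowD_mono hmonoG (ih m hsmall d v ε hε)
    -- split `m = c + e'` with `c = m / 2 ≤ e' ≤ 2^t`
    obtain ⟨c, e', rfl, hc, he', hce⟩ : ∃ c e', m = c + e' ∧ c ≤ 2 ^ t ∧ e' ≤ 2 ^ t ∧ c ≤ e' := by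
      refine ⟨m / 2, m - m / 2, by omega, ?_, ?_, by omega⟩
      · have : 2 ^ (t + 1) = 2 * 2 ^ t := by ring
        omega
      · have : 2 ^ (t + 1) = 2 * 2 ^ t := by ring
        omega
    classical
    set 𝓡 := ((univ : Finset (Fin (c + e'))).filter (fun x : Fin (c + e') => x.val < c + w)).powersetCard c
      with h𝓡def
    have hsplit := designRowD_split d v ε 𝓡 (fun R hR => (mem_powersetCard.mp hR).2)
      (B₁ := G - 1) (B₂ := G - 1)
      (fun R _ r _ => ih c hc d _ _ (band_restrict_left w ε hε r))
      (fun R hR r hr => ih e' he' d _ _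
        (band_restrict_right w ε hε R (mem_powersetCard.mp hR).1 (mem_powersetCard.mp hR).2 r hr))
      (fun q hq => band_state_mem w ε hε q hq)
    refine designRowD_mono ?_ hsplit
    -- arithmetic: `#𝓡·(2(G − 1) + 1) − 1 ≤ (K+1)·2^((w+1)(t+1)(t+2)) − 1` using `#𝓡 ≤ (c+1)^w ≤ 2^((t+1)w)`
    have hstates : 𝓡.card ≤ 2 ^ ((t + 1) * w) := by
      calc 𝓡.card ≤ (c + 1) ^ w := card_bandStates_le w
        _ ≤ (2 ^ (t + 1)) ^ w := Nat.pow_le_pow_left (by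
            have : 2 ^ (t + 1) = 2 * 2 ^ t := by ring
            have : 1 ≤ 2 ^ t := Nat.one_le_two_pow
            omega) w
        _ = 2 ^ ((t + 1) * w) := by rw [← pow_mul]
    have hGpos : 1 ≤ G := by
      have : 1 ≤ 2 ^ ((w + 1) * (t * (t + 1))) := Nat.one_le_two_pow
      simp only [hG]; nlinarith
    have h1 : 𝓡.card * (G - 1 + (G - 1) + 1) ≤ 2 ^ ((t + 1) * w) * (2 * G) :=
      calc 𝓡.card * (G - 1 + (G - 1) + 1) ≤ 2 ^ ((t + 1) * w) * (G - 1 + (G - 1) + 1) :=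
            Nat.mul_le_mul_right _ hstates
        _ ≤ 2 ^ ((t + 1) * w) * (2 * G) := Nat.mul_le_mul_left _ (by omega)
    have h2 : 2 ^ ((t + 1) * w) * (2 * G) ≤ (K + 1) * 2 ^ ((w + 1) * ((t + 1) * (t + 1 + 1))) := by
      have hexp : 2 ^ ((t + 1) * w) * 2 * 2 ^ ((w + 1) * (t * (t + 1))) ≤
          2 ^ ((w + 1) * ((t + 1) * (t + 1 + 1))) := by
        rw [← pow_succ, ← pow_add]
        exact Nat.pow_le_pow_right (by norm_num) (by nlinarith)
      calc 2 ^ ((t + 1) * w) * (2 * G) = (K + 1) * (2 ^ ((t + 1) * w) * 2 * 2 ^ ((w + 1) * (t * (t + 1)))) := by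
            simp only [hG]; ring
        _ ≤ (K + 1) * 2 ^ ((w + 1) * ((t + 1) * (t + 1 + 1))) := Nat.mul_le_mul_left _ hexp
    omega

/-- **Gusfield's bound, banded form.**  Every design of lower bandwidth `w` and format `(m, K)` has unsigned row bound
`(K + 1)·2^((w+1)·(log₂ m + 1)·(log₂ m + 2)) − 1`. [folklore: Gusfield 1980, banded form] -/
theorem designRowD_band {m K : ℕ} (w : ℕ) (d : Fin K → ℕ) (v ε : Fin m → Fin m → Fin K → ℤ)
    (hε : ∀ a b l, ε a b l ≠ 0 → (a : ℕ) ≤ (b : ℕ) + w) :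
    DesignRowD d v ε ((K + 1) * 2 ^ ((w + 1) * ((Nat.log 2 m + 1) * (Nat.log 2 m + 2))) - 1) :=
  designRowD_band_pow K w (Nat.log 2 m + 1) m (Nat.lt_pow_succ_log_self (by norm_num) m).le d v ε hε

/-- arithmetic, fixed width: for `L ≥ 1` the banded bound sits inside the `K + log² m` budget with `C = 6w + 7`. [folklore] -/
theorem bandBound_le_fixedWidth (K L w : ℕ) (hL : 1 ≤ L) :
    (K + 1) * 2 ^ ((w + 1) * ((L + 1) * (L + 2))) - 1 ≤ 2 ^ ((6 * w + 7) * (K + L ^ 2)) := by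
  have hK : K + 1 ≤ 2 ^ K := Nat.lt_two_pow_self
  have hLL : (L + 1) * (L + 2) ≤ 6 * L ^ 2 := by nlinarith
  calc (K + 1) * 2 ^ ((w + 1) * ((L + 1) * (L + 2))) - 1 ≤ (K + 1) * 2 ^ ((w + 1) * ((L + 1) * (L + 2))) :=
        Nat.sub_le _ _
    _ ≤ 2 ^ K * 2 ^ ((w + 1) * ((L + 1) * (L + 2))) := Nat.mul_le_mul_right _ hK
    _ = 2 ^ (K + (w + 1) * ((L + 1) * (L + 2))) := by rw [← pow_add]
    _ ≤ 2 ^ ((6 * w + 7) * (K + L ^ 2)) := Nat.pow_le_pow_right (by norm_num) (by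
        have := Nat.mul_le_mul_left (w + 1) hLL
        nlinarith)

/-- arithmetic, K-adaptive width: for `L ≥ 1` and `w·L² ≤ K` the banded bound sits inside the budget with `C = 7`.
[folklore] -/
theorem bandBound_le_adaptive (K L w : ℕ) (hL : 1 ≤ L) (hw : w * L ^ 2 ≤ K) :
    (K + 1) * 2 ^ ((w + 1) * ((L + 1) * (L + 2))) - 1 ≤ 2 ^ (7 * (K + L ^ 2)) := by
  have hK : K + 1 ≤ 2 ^ K := Nat.lt_two_pow_self
  have hLL : (L + 1) * (L + 2) ≤ 6 * L ^ 2 := by nlinarith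
  have hmain : (w + 1) * ((L + 1) * (L + 2)) ≤ 6 * K + 6 * L ^ 2 := by
    calc (w + 1) * ((L + 1) * (L + 2)) ≤ (w + 1) * (6 * L ^ 2) := Nat.mul_le_mul_left _ hLL
      _ = 6 * (w * L ^ 2) + 6 * L ^ 2 := by ring
      _ ≤ 6 * K + 6 * L ^ 2 := by omega
  calc (K + 1) * 2 ^ ((w + 1) * ((L + 1) * (L + 2))) - 1 ≤ (K + 1) * 2 ^ ((w + 1) * ((L + 1) * (L + 2))) :=
        Nat.sub_le _ _
    _ ≤ 2 ^ K * 2 ^ ((w + 1) * ((L + 1) * (L + 2))) := Nat.mul_le_mul_right _ hK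
    _ = 2 ^ (K + (w + 1) * ((L + 1) * (L + 2))) := by rw [← pow_add]
    _ ≤ 2 ^ (7 * (K + L ^ 2)) := Nat.pow_le_pow_right (by norm_num) (by omega)

/-- the `m ≤ 1` corner: at most `K − 1` breakpoints, inside any budget `2^(C·(K + L²))` with `C ≥ 1`. [folklore] -/
theorem designRowD_small {m K : ℕ} (hm : m ≤ 1) (C : ℕ) (hC : 1 ≤ C) (d : Fin K → ℕ)
    (v ε : Fin m → Fin m → Fin K → ℤ) : DesignRowD d v ε (2 ^ (C * (K + Nat.log 2 m ^ 2))) := by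
  have hK : K - 1 ≤ 2 ^ (C * (K + Nat.log 2 m ^ 2)) := by
    have : K < 2 ^ K := Nat.lt_two_pow_self
    have : 2 ^ K ≤ 2 ^ (C * (K + Nat.log 2 m ^ 2)) := Nat.pow_le_pow_right (by norm_num) (by nlinarith)
    omega
  rcases Nat.le_one_iff_eq_zero_or_eq_one.mp hm with rfl | rfl
  · exact designRowD_mono (Nat.zero_le _) (tropRowD_size_zero K 0 d v ε)
  · exact designRowD_mono hK (tropRowD_one K d v ε)

/-- **The `K + log² m` law on the banded class, fixed width (unsigned form): `C = 6w + 7`.** [folklore: Gusfield 1980,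
banded form, in the dominance vocabulary] -/
theorem band_kPlusLogSq_fixedWidth_unsigned {m K : ℕ} (w : ℕ) (d : Fin K → ℕ) (v ε : Fin m → Fin m → Fin K → ℤ)
    (hε : ∀ a b l, ε a b l ≠ 0 → (a : ℕ) ≤ (b : ℕ) + w) :
    DesignRowD d v ε (2 ^ ((6 * w + 7) * (K + Nat.log 2 m ^ 2))) := by
  rcases Nat.lt_or_ge m 2 with hm | hm
  · exact designRowD_small (by omega) _ (by omega) d v ε
  · have hL : 1 ≤ Nat.log 2 m := Nat.log_pos (by norm_num) hm
    exact designRowD_mono (bandBound_le_fixedWidth K _ w hL) (designRowD_band w d v ε hε)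

/-- **The `K + log² m` law on the K-ADAPTIVE banded class (unsigned form): ONE constant `C = 7` for every design whose
lower bandwidth `w` satisfies `w · log₂² m ≤ K`.** [folklore: Gusfield 1980, banded form, in the dominance vocabulary] -/
theorem band_kPlusLogSq_unsigned {m K : ℕ} (w : ℕ) (d : Fin K → ℕ) (v ε : Fin m → Fin m → Fin K → ℤ)
    (hε : ∀ a b l, ε a b l ≠ 0 → (a : ℕ) ≤ (b : ℕ) + w) (hw : w * Nat.log 2 m ^ 2 ≤ K) :
    DesignRowD d v ε (2 ^ (7 * (K + Nat.log 2 m ^ 2))) := by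
  rcases Nat.lt_or_ge m 2 with hm | hm
  · exact designRowD_small (by omega) _ (by omega) d v ε
  · have hL : 1 ≤ Nat.log 2 m := Nat.log_pos (by norm_num) hm
    exact designRowD_mono (bandBound_le_adaptive K _ w hL hw) (designRowD_band w d v ε hε)

/-- **The `K + log² m` law on the banded class, fixed width.**  For every `w` there is `C` (`= 6w + 7`) such that for
all `m, K` and every design of format `(m, K)` of lower bandwidth `w`, every chain of terms dominant at strictly
increasing integer slopes with alternating signs has at most `2^(C·(K + (log₂ m)²))` breakpoints — the statement of the
crux `TropicalB` restricted to the banded class (`w = 1`: the Hessenberg class of val-sym-trop-p5's theorem).  HONEST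
RANGE: a restricted class, one constant per width. [folklore: Gusfield 1980, in the dominance vocabulary] -/
theorem band_kPlusLogSq_fixedWidth (w : ℕ) : ∃ C : ℕ, ∀ (m K : ℕ) (d : Fin K → ℕ)
    (v ε : Fin m → Fin m → Fin K → ℤ), (∀ a b l, ε a b l ≠ 0 → (a : ℕ) ≤ (b : ℕ) + w) →
    ∀ (n : ℕ) (θ : Fin (n + 1) → ℤ) (p : Fin (n + 1) → Equiv.Perm (Fin m) × (Fin m → Fin K)),
      (∀ i j l, (ε i j l).natAbs ≤ 1) → StrictMono θ → (∀ k, IsDominant d v ε (θ k) (p k)) →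
      (∀ k : Fin n, termSign ε (p k.castSucc) * termSign ε (p k.succ) < 0) →
      n ≤ 2 ^ (C * (K + Nat.log 2 m ^ 2)) :=
  ⟨6 * w + 7, fun _ _ d v ε hε _ θ p _ hθ hdom halt =>
    le_of_designRowD (band_kPlusLogSq_fixedWidth_unsigned w d v ε hε) θ p hθ hdom halt⟩

/-- **The `K + log² m` law on the K-adaptive banded class: ONE absolute constant.**  For all `m, K, w` with
`w · (log₂ m)² ≤ K` and every design of format `(m, K)` of lower bandwidth `w`, every chain of terms dominant at
strictly increasing integer slopes with alternating signs has at most `2^(7·(K + (log₂ m)²))` breakpoints.  In the fat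
regime `(log₂ m)² ≤ K` of `stub_tropFat` this admits bandwidth `K / (log₂ m)²`, a sector that widens with `K`.  HONEST
RANGE: a restricted class; `TropicalB` quantifies over all designs. [folklore: Gusfield 1980, in the dominance vocabulary] -/
theorem band_kPlusLogSq {m K : ℕ} (w : ℕ) (d : Fin K → ℕ) (v ε : Fin m → Fin m → Fin K → ℤ)
    (hε : ∀ a b l, ε a b l ≠ 0 → (a : ℕ) ≤ (b : ℕ) + w) (hw : w * Nat.log 2 m ^ 2 ≤ K)
    {n : ℕ} (θ : Fin (n + 1) → ℤ) (p : Fin (n + 1) → Equiv.Perm (Fin m) × (Fin m → Fin K))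
    (hθ : StrictMono θ) (hdom : ∀ k, IsDominant d v ε (θ k) (p k))
    (halt : ∀ k : Fin n, termSign ε (p k.castSucc) * termSign ε (p k.succ) < 0) :
    n ≤ 2 ^ (7 * (K + Nat.log 2 m ^ 2)) :=
  le_of_designRowD (band_kPlusLogSq_unsigned w d v ε hε hw) θ p hθ hdom halt

/-- **Relabeled banded designs.**  If some relabeling of rows and columns (`π`, `ρ`) makes the support banded of width
`w` with `w · (log₂ m)² ≤ K`, the same bound `2^(7·(K + (log₂ m)²))` holds (dominant chains are invariant under
relabeling, val-sym-trop-p1's `designRowD_of_relabel`).  Example: a support inside two permutation matrices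
`{(b, b), (π b, b)}` is Hessenberg (`w = 1`) after ordering rows and columns along the cycles of `π`. [folklore] -/
theorem band_kPlusLogSq_of_relabel {m K : ℕ} (w : ℕ) (d : Fin K → ℕ) (v ε : Fin m → Fin m → Fin K → ℤ)
    (π ρ : Equiv.Perm (Fin m)) (hε : ∀ a b l, ε (π a) (ρ b) l ≠ 0 → (a : ℕ) ≤ (b : ℕ) + w)
    (hw : w * Nat.log 2 m ^ 2 ≤ K)
    {n : ℕ} (θ : Fin (n + 1) → ℤ) (p : Fin (n + 1) → Equiv.Perm (Fin m) × (Fin m → Fin K))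
    (hθ : StrictMono θ) (hdom : ∀ k, IsDominant d v ε (θ k) (p k))
    (halt : ∀ k : Fin n, termSign ε (p k.castSucc) * termSign ε (p k.succ) < 0) :
    n ≤ 2 ^ (7 * (K + Nat.log 2 m ^ 2)) :=
  le_of_designRowD (designRowD_of_relabel d v ε π ρ
    (band_kPlusLogSq_unsigned w d (fun a b l => v (π a) (ρ b) l) (fun a b l => ε (π a) (ρ b) l) hε hw))
    θ p hθ hdom halt

/-- **Upper-banded designs** (`ε a b l ≠ 0 → b ≤ a + w`): the same bound, by the order-reversing relabeling of rows and
columns (`Fin.revPerm`), which turns an upper band into a lower band. [folklore] -/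
theorem band_kPlusLogSq_upper {m K : ℕ} (w : ℕ) (d : Fin K → ℕ) (v ε : Fin m → Fin m → Fin K → ℤ)
    (hε : ∀ a b l, ε a b l ≠ 0 → (b : ℕ) ≤ (a : ℕ) + w) (hw : w * Nat.log 2 m ^ 2 ≤ K)
    {n : ℕ} (θ : Fin (n + 1) → ℤ) (p : Fin (n + 1) → Equiv.Perm (Fin m) × (Fin m → Fin K))
    (hθ : StrictMono θ) (hdom : ∀ k, IsDominant d v ε (θ k) (p k))
    (halt : ∀ k : Fin n, termSign ε (p k.castSucc) * termSign ε (p k.succ) < 0) :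
    n ≤ 2 ^ (7 * (K + Nat.log 2 m ^ 2)) := by
  refine band_kPlusLogSq_of_relabel w d v ε Fin.revPerm Fin.revPerm (fun a b l h => ?_) hw θ p hθ hdom halt
  have h1 := hε _ _ _ h
  simp only [Fin.revPerm_apply, Fin.val_rev] at h1
  have := a.isLt; have := b.isLt
  omega

end Summit.ValiantsHypothesis.ValiantsHypothesis.Theorems.KPlusLogSqLaw
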